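import Literature.NumberTheory.Automorphic.ArchRankOneHyperbolicKernel               -- ★ p850008 (A0 chart half): brings (K0±) `ArchRankOneJumpZero`, the cone integrands, Mathlib analysis
import Literature.MeasureTheory.Group.SL2IwasawaHaar                                  -- ★ `continuous_cosA`, `continuous_sinA`, `cosA_coe`, `sinA_coe` (trigonometry on `AddCircle (2π)`)
import Mathlib.MeasureTheory.Integral.IntervalIntegral.Periodic                       -- `AddCircle (2π)`, `AddCircle.integral_preimage`, `Function.Periodic.intervalIntegral_add_eq`
import Mathlib.MeasureTheory.Measure.Haar.NormedSpace                                 -- `Measure.integral_comp_mul_left`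
import HarnessLib

/-!
# (A0-c), CHART LEVEL: the `K₁ × N` cone functional of the split side equals twice the (K0±) two-nappe cone value —
# `∫_{ℝ∕2πℤ × ℝ} f(z·(1 + iu·Ad(k_s)E₀₁)) ds du = 2 · [cone⁺(f, z) + cone⁻(f, z)]` via the half-angle identity `Ad(k_{θ∕2})E₀₁ = ½ P M(θ) P⁻¹`

Topic `NumberTheory/Automorphic`; namespace `Literature.NumberTheory.Automorphic`.  KERNEL mathematics only: theorems, no definition, no named fact, no instance, no
notation, no `sorry`.  Cell `pub/hodgecm-mathlib`, line LH3 (closer stub `stub_N9`, crux H413 = `stmt-HodgeConjecture-24833`), DIRECT ROAD brick **(A0-c)**, chart half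
(pen F0P3a-p05 (g19); LH3-plan (g3) 2026-09-02T07:24:10Z (c3) «state the (A0) value as `C₂·(cone⁺ + cone⁻)`»).  The group half of (A0-c) is FILE
`ArchRankOneSplitConeMatching` (★ FILE 1∕2 + ★ (IWA) `ArchRankOneSplitIwasawa` + this file).

THE MATHEMATICS.  In the tree frame `Φ₂ = antidiag(1,1)` the unipotent cone through the circle `K₁ = {k_s}` of ★ (IWA) is `k_s [[1, y], [0, 1]] k_s⁻¹ =
1 + y · A(s)`, `A(s) = (i sin s cos s, cos² s; sin² s, −i sin s cos s) = Ad(k_s)E₀₁`, `y = iu ∈ iℝ`; in the ball frame the (K0±) half-cones at `z·1` are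
`z·1 ± τ·(zi) M(θ)`, `(zi) M(θ) = diag(zi, −zi) + W θ`, carried to the tree frame by the Cayley matrix `P = (1 1; 1 −1)`, `P⁻¹ = ½P` (★ `ArchRankOneJumpZeroCayley`).
§1 THE HALF-ANGLE IDENTITY: **`P · (z·1 + τ·diag(zi,−zi) + τ·W θ) · ½P = z · (1 + (2τ) i · A(θ∕2))`** and its `−` twin (`τ ↦ −τ`): the Cayley image of the (K0±)
cone point `(τ, θ)` is the `K₁ × N` cone point `(s, u) = (θ∕2, ±2τ)`.  §2–§3 BOOKKEEPING (`f` continuous, compact support; `z ≠ 0`): `h(s, u) = f(z·(1 + iu·A(s)))`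
is continuous, `π`-periodic in `s`, supported in `|u| ≤ R` uniformly in `s`; Fubini, `u = ±2τ`, `s = θ∕2` and periodicity give
  **`∫_{ℝ∕2πℤ × ℝ} f(z·(1 + iu·A(s))) d(s,u) = 2 · [cone⁺(f,z) + cone⁻(f,z)]`** (`integral_addCircle_prod_coneChart_eq_two_smul_cone`),
`cone^±` VERBATIM the two half-cone integrals of ★ `exists_tendsto_two_sin_smul_orbitalIntegral_cayley_nhdsGT_nhdsLT` (with `(z : ℂ)` for `z : Circle`).
HONEST LABEL: HC_CM is proved only modulo the 7 printed citations (2 remaining: hLiu418 = stmt-HodgeConjecture-24832, h413 = stmt-HodgeConjecture-24833) until rung 0 closes;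
real analysis over Mathlib, count-neutral, pays nothing by itself.

## References
* [Varadarajan1989] V. S. Varadarajan, *An Introduction to Harmonic Analysis on Semisimple Lie Groups*, Cambridge Stud. Adv. Math. 16 (1989), §6.4 Lemma 21, Thm 23
  (Rao's nilpotent-cone integral as the value of `F_f^A` at the centre).
* [Rogawski1990] J. D. Rogawski, *Automorphic Representations of Unitary Groups in Three Variables*, Ann. of Math. Stud. 123 (1990), §3.1 p. 19, §8.2 pp. 119, 122.
* [Shelstad1979] D. Shelstad, *Characters and inner forms of a quasi-split group over ℝ*, Compositio Math. 39 (1979), Lemma 4.3 p. 25. -/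

set_option autoImplicit false

noncomputable section

namespace Literature.NumberTheory.Automorphic

open _root_.MeasureTheory Set Filter _root_.Topology
open scoped Real

variable {E : Type*} [NormedAddCommGroup E] [NormedSpace ℝ E]

/-! ## §1 The half-angle identity: the Cayley image of the (K0±) cone is the `K₁ × N` cone -/

/-- `e^{iθ} = (2cos²(θ∕2) − 1) + 2 sin(θ∕2) cos(θ∕2) · i` (double angle). [cite: Varadarajan1989, §6.4 Lemma 21] -/
theorem cexp_mul_I_eq_half_angle (θ : ℝ) :
    Complex.exp ((θ : ℂ) * Complex.I) =
      (2 * ((Real.cos (θ / 2) : ℝ) : ℂ) ^ 2 - 1) + (2 * ((Real.sin (θ / 2) : ℝ) : ℂ) * ((Real.cos (θ / 2) : ℝ) : ℂ)) * Complex.I := by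
  have hθ : (θ : ℂ) = ((2 * (θ / 2) : ℝ) : ℂ) := by push_cast; ring
  rw [hθ, Complex.exp_mul_I, ← Complex.ofReal_cos, ← Complex.ofReal_sin, Real.cos_two_mul, Real.sin_two_mul]
  push_cast
  ring

/-- `e^{−iθ} = (2cos²(θ∕2) − 1) − 2 sin(θ∕2) cos(θ∕2) · i`. [cite: Varadarajan1989, §6.4 Lemma 21] -/
theorem cexp_neg_mul_I_eq_half_angle (θ : ℝ) :
    Complex.exp (-((θ : ℂ) * Complex.I)) =
      (2 * ((Real.cos (θ / 2) : ℝ) : ℂ) ^ 2 - 1) - (2 * ((Real.sin (θ / 2) : ℝ) : ℂ) * ((Real.cos (θ / 2) : ℝ) : ℂ)) * Complex.I := by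
  have hθ : -((θ : ℂ) * Complex.I) = (((-(2 * (θ / 2))) : ℝ) : ℂ) * Complex.I := by push_cast; ring
  rw [hθ, Complex.exp_mul_I, ← Complex.ofReal_cos, ← Complex.ofReal_sin, Real.cos_neg, Real.sin_neg, Real.cos_two_mul, Real.sin_two_mul]
  push_cast
  ring

/-- **THE HALF-ANGLE IDENTITY, `+` NAPPE**: `P · (z·1 + τ·diag(zi,−zi) + τ·W θ) · ½P = z · (1 + (2τ)i · A(θ∕2))`, `A(s) = (i sin s cos s, cos² s; sin² s, −i sin s cos s)` —
the Cayley image of the (K0±) `+` half-cone point is the `K₁ × N` cone point `(s, u) = (θ∕2, 2τ)`. [cite: Rogawski1990, §8.2 p. 122] [cite: Varadarajan1989, §6.4] -/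
theorem cayley_conePlus_eq_smul (z : ℂ) (τ θ : ℝ) :
    (!![(1 : ℂ), 1; 1, -1] : Matrix (Fin 2) (Fin 2) ℂ) *
        (z • (1 : Matrix (Fin 2) (Fin 2) ℂ) + τ • Matrix.diagonal ![z * Complex.I, -(z * Complex.I)] +
          τ • !![(0 : ℂ), -(z * Complex.I) * Complex.exp (-((θ : ℂ) * Complex.I)); (z * Complex.I) * Complex.exp ((θ : ℂ) * Complex.I), 0]) *
        !![(1 / 2 : ℂ), 1 / 2; 1 / 2, -(1 / 2)] =
      z • ((1 : Matrix (Fin 2) (Fin 2) ℂ) + ((((2 * τ : ℝ)) : ℂ) * Complex.I) •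
        !![Complex.I * ((Real.sin (θ / 2) : ℝ) : ℂ) * ((Real.cos (θ / 2) : ℝ) : ℂ), ((Real.cos (θ / 2) : ℝ) : ℂ) ^ 2;
           ((Real.sin (θ / 2) : ℝ) : ℂ) ^ 2, -(Complex.I * ((Real.sin (θ / 2) : ℝ) : ℂ) * ((Real.cos (θ / 2) : ℝ) : ℂ))]) := by
  have htrig : ((Real.cos (θ / 2) : ℝ) : ℂ) ^ 2 + ((Real.sin (θ / 2) : ℝ) : ℂ) ^ 2 = 1 := by exact_mod_cast Real.cos_sq_add_sin_sq (θ / 2)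
  rw [cexp_mul_I_eq_half_angle, cexp_neg_mul_I_eq_half_angle]
  set c : ℂ := ((Real.cos (θ / 2) : ℝ) : ℂ) with hc
  set sn : ℂ := ((Real.sin (θ / 2) : ℝ) : ℂ) with hsn
  have hM : z • (1 : Matrix (Fin 2) (Fin 2) ℂ) + τ • Matrix.diagonal ![z * Complex.I, -(z * Complex.I)] +
      τ • !![(0 : ℂ), -(z * Complex.I) * ((2 * c ^ 2 - 1) - (2 * sn * c) * Complex.I); (z * Complex.I) * ((2 * c ^ 2 - 1) + (2 * sn * c) * Complex.I), 0] =
      !![z + (τ : ℂ) * (z * Complex.I), (τ : ℂ) * (-(z * Complex.I) * ((2 * c ^ 2 - 1) - (2 * sn * c) * Complex.I));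
         (τ : ℂ) * ((z * Complex.I) * ((2 * c ^ 2 - 1) + (2 * sn * c) * Complex.I)), z - (τ : ℂ) * (z * Complex.I)] := by
    ext i j
    fin_cases i <;> fin_cases j <;> simp [Matrix.diagonal, Complex.real_smul]
    all_goals ring
  rw [hM]
  ext i j
  fin_cases i <;> fin_cases j <;> simp [Matrix.mul_apply, Fin.sum_univ_two]
  · linear_combination
  · linear_combination
  · linear_combination (-2 * (τ : ℂ) * z * Complex.I) * htrig
  · linear_combination

/-- **THE HALF-ANGLE IDENTITY, `−` NAPPE**: `P · (z·1 + τ·diag(−zi,zi) + τ·W⁻ θ) · ½P = z · (1 + (−2τ)i · A(θ∕2))` — the point `(s, u) = (θ∕2, −2τ)`.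
[cite: Rogawski1990, §8.2 p. 122] [cite: Varadarajan1989, §6.4] -/
theorem cayley_coneMinus_eq_smul (z : ℂ) (τ θ : ℝ) :
    (!![(1 : ℂ), 1; 1, -1] : Matrix (Fin 2) (Fin 2) ℂ) *
        (z • (1 : Matrix (Fin 2) (Fin 2) ℂ) + τ • Matrix.diagonal ![-(z * Complex.I), z * Complex.I] +
          τ • !![(0 : ℂ), (z * Complex.I) * Complex.exp (-((θ : ℂ) * Complex.I)); -(z * Complex.I) * Complex.exp ((θ : ℂ) * Complex.I), 0]) *
        !![(1 / 2 : ℂ), 1 / 2; 1 / 2, -(1 / 2)] =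
      z • ((1 : Matrix (Fin 2) (Fin 2) ℂ) + ((((-(2 * τ) : ℝ)) : ℂ) * Complex.I) •
        !![Complex.I * ((Real.sin (θ / 2) : ℝ) : ℂ) * ((Real.cos (θ / 2) : ℝ) : ℂ), ((Real.cos (θ / 2) : ℝ) : ℂ) ^ 2;
           ((Real.sin (θ / 2) : ℝ) : ℂ) ^ 2, -(Complex.I * ((Real.sin (θ / 2) : ℝ) : ℂ) * ((Real.cos (θ / 2) : ℝ) : ℂ))]) := by
  have htrig : ((Real.cos (θ / 2) : ℝ) : ℂ) ^ 2 + ((Real.sin (θ / 2) : ℝ) : ℂ) ^ 2 = 1 := by exact_mod_cast Real.cos_sq_add_sin_sq (θ / 2)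
  rw [cexp_mul_I_eq_half_angle, cexp_neg_mul_I_eq_half_angle]
  set c : ℂ := ((Real.cos (θ / 2) : ℝ) : ℂ) with hc
  set sn : ℂ := ((Real.sin (θ / 2) : ℝ) : ℂ) with hsn
  have hM : z • (1 : Matrix (Fin 2) (Fin 2) ℂ) + τ • Matrix.diagonal ![-(z * Complex.I), z * Complex.I] +
      τ • !![(0 : ℂ), (z * Complex.I) * ((2 * c ^ 2 - 1) - (2 * sn * c) * Complex.I); -(z * Complex.I) * ((2 * c ^ 2 - 1) + (2 * sn * c) * Complex.I), 0] =
      !![z - (τ : ℂ) * (z * Complex.I), (τ : ℂ) * ((z * Complex.I) * ((2 * c ^ 2 - 1) - (2 * sn * c) * Complex.I));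
         (τ : ℂ) * (-(z * Complex.I) * ((2 * c ^ 2 - 1) + (2 * sn * c) * Complex.I)), z + (τ : ℂ) * (z * Complex.I)] := by
    ext i j
    fin_cases i <;> fin_cases j <;> simp [Matrix.diagonal, Complex.real_smul]
    all_goals ring
  rw [hM]
  ext i j
  fin_cases i <;> fin_cases j <;> simp [Matrix.mul_apply, Fin.sum_univ_two]
  · linear_combination
  · linear_combination
  · linear_combination (2 * (τ : ℂ) * z * Complex.I) * htrig
  · linear_combination

/-! ## §2 The cone chart `h(s, u) = f(z·(1 + iu·A(s)))`: continuity, `π`-periodicity, uniform support bound, integrability -/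

/-- `s ↦ A(s) = (i sin s cos s, cos² s; sin² s, −i sin s cos s)` is continuous. [cite: Varadarajan1989, §6.4 Lemma 21] -/
theorem continuous_coneDir :
    Continuous fun s : ℝ => (!![Complex.I * ((Real.sin s : ℝ) : ℂ) * ((Real.cos s : ℝ) : ℂ), ((Real.cos s : ℝ) : ℂ) ^ 2;
      ((Real.sin s : ℝ) : ℂ) ^ 2, -(Complex.I * ((Real.sin s : ℝ) : ℂ) * ((Real.cos s : ℝ) : ℂ))] : Matrix (Fin 2) (Fin 2) ℂ) := by
  refine continuous_matrix fun i j => ?_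
  fin_cases i <;> fin_cases j <;> simp <;> fun_prop

/-- `A` on the angle group `ℝ∕2πℤ` (through `Real.Angle.cos`, `Real.Angle.sin`) is continuous. [cite: Varadarajan1989, §6.4 Lemma 21] -/
theorem continuous_coneDir_addCircle :
    Continuous fun s : AddCircle (2 * π) => (!![Complex.I * ((Real.Angle.sin s : ℝ) : ℂ) * ((Real.Angle.cos s : ℝ) : ℂ), ((Real.Angle.cos s : ℝ) : ℂ) ^ 2;
      ((Real.Angle.sin s : ℝ) : ℂ) ^ 2, -(Complex.I * ((Real.Angle.sin s : ℝ) : ℂ) * ((Real.Angle.cos s : ℝ) : ℂ))] : Matrix (Fin 2) (Fin 2) ℂ) := by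
  have hc : Continuous fun s : AddCircle (2 * π) => ((Real.Angle.cos s : ℝ) : ℂ) :=
    Complex.continuous_ofReal.comp Literature.MeasureTheory.Group.continuous_cosA
  have hs : Continuous fun s : AddCircle (2 * π) => ((Real.Angle.sin s : ℝ) : ℂ) :=
    Complex.continuous_ofReal.comp Literature.MeasureTheory.Group.continuous_sinA
  refine continuous_matrix fun i j => ?_
  fin_cases i <;> fin_cases j
  · exact (continuous_const.mul hs).mul hc
  · exact hc.pow 2
  · exact hs.pow 2
  · exact ((continuous_const.mul hs).mul hc).neg

omit [NormedSpace ℝ E] in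
/-- The cone chart `(s, u) ↦ f(z·(1 + iu·A(s)))` is continuous on `ℝ × ℝ` for continuous `f`. [cite: Varadarajan1989, §6.4 Lemma 21] -/
theorem continuous_coneChart (f : Matrix (Fin 2) (Fin 2) ℂ → E) (hf : Continuous f) (z : ℂ) :
    Continuous fun p : ℝ × ℝ => f (z • ((1 : Matrix (Fin 2) (Fin 2) ℂ) + (((p.2 : ℝ) : ℂ) * Complex.I) •
      !![Complex.I * ((Real.sin p.1 : ℝ) : ℂ) * ((Real.cos p.1 : ℝ) : ℂ), ((Real.cos p.1 : ℝ) : ℂ) ^ 2;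
        ((Real.sin p.1 : ℝ) : ℂ) ^ 2, -(Complex.I * ((Real.sin p.1 : ℝ) : ℂ) * ((Real.cos p.1 : ℝ) : ℂ))])) := by
  refine hf.comp ((continuous_const (y := z)).smul (continuous_const.add ?_))
  have hu : Continuous fun p : ℝ × ℝ => ((p.2 : ℝ) : ℂ) * Complex.I := (Complex.continuous_ofReal.comp continuous_snd).mul continuous_const
  exact hu.smul (continuous_coneDir.comp continuous_fst)

omit [NormedSpace ℝ E] in
/-- The cone chart in the order `(u, s)` is continuous (the `Function.uncurry` shape of Mathlib's parametric interval integrals). [cite: Varadarajan1989, §6.4 Lemma 21] -/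
theorem continuous_coneChart_swap (f : Matrix (Fin 2) (Fin 2) ℂ → E) (hf : Continuous f) (z : ℂ) :
    Continuous (Function.uncurry fun u s : ℝ => f (z • ((1 : Matrix (Fin 2) (Fin 2) ℂ) + (((u : ℝ) : ℂ) * Complex.I) •
      !![Complex.I * ((Real.sin s : ℝ) : ℂ) * ((Real.cos s : ℝ) : ℂ), ((Real.cos s : ℝ) : ℂ) ^ 2;
        ((Real.sin s : ℝ) : ℂ) ^ 2, -(Complex.I * ((Real.sin s : ℝ) : ℂ) * ((Real.cos s : ℝ) : ℂ))]))) := by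
  refine hf.comp ((continuous_const (y := z)).smul (continuous_const.add ?_))
  have hu : Continuous fun p : ℝ × ℝ => ((p.1 : ℝ) : ℂ) * Complex.I := (Complex.continuous_ofReal.comp continuous_fst).mul continuous_const
  exact hu.smul (continuous_coneDir.comp continuous_snd)

omit [NormedSpace ℝ E] in
/-- The cone chart on `ℝ∕2πℤ × ℝ` is continuous. [cite: Varadarajan1989, §6.4 Lemma 21] -/
theorem continuous_coneChart_addCircle (f : Matrix (Fin 2) (Fin 2) ℂ → E) (hf : Continuous f) (z : ℂ) :
    Continuous fun p : AddCircle (2 * π) × ℝ => f (z • ((1 : Matrix (Fin 2) (Fin 2) ℂ) + (((p.2 : ℝ) : ℂ) * Complex.I) •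
      !![Complex.I * ((Real.Angle.sin p.1 : ℝ) : ℂ) * ((Real.Angle.cos p.1 : ℝ) : ℂ), ((Real.Angle.cos p.1 : ℝ) : ℂ) ^ 2;
        ((Real.Angle.sin p.1 : ℝ) : ℂ) ^ 2, -(Complex.I * ((Real.Angle.sin p.1 : ℝ) : ℂ) * ((Real.Angle.cos p.1 : ℝ) : ℂ))])) := by
  refine hf.comp ((continuous_const (y := z)).smul (continuous_const.add ?_))
  have hu : Continuous fun p : AddCircle (2 * π) × ℝ => ((p.2 : ℝ) : ℂ) * Complex.I := (Complex.continuous_ofReal.comp continuous_snd).mul continuous_const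
  exact hu.smul (continuous_coneDir_addCircle.comp continuous_fst)

/-- **`π`-PERIODICITY**: `A(s + π) = A(s)` (`cos(s+π) = −cos s`, `sin(s+π) = −sin s`; the entries are quadratic) — `Ad(k_{s+π}) = Ad(−k_s) = Ad(k_s)`. [cite: Varadarajan1989, §6.4 Lemma 21] -/
theorem coneDir_add_pi (s : ℝ) :
    (!![Complex.I * ((Real.sin (s + π) : ℝ) : ℂ) * ((Real.cos (s + π) : ℝ) : ℂ), ((Real.cos (s + π) : ℝ) : ℂ) ^ 2;
        ((Real.sin (s + π) : ℝ) : ℂ) ^ 2, -(Complex.I * ((Real.sin (s + π) : ℝ) : ℂ) * ((Real.cos (s + π) : ℝ) : ℂ))] : Matrix (Fin 2) (Fin 2) ℂ) =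
      !![Complex.I * ((Real.sin s : ℝ) : ℂ) * ((Real.cos s : ℝ) : ℂ), ((Real.cos s : ℝ) : ℂ) ^ 2;
        ((Real.sin s : ℝ) : ℂ) ^ 2, -(Complex.I * ((Real.sin s : ℝ) : ℂ) * ((Real.cos s : ℝ) : ℂ))] := by
  rw [Real.sin_add_pi, Real.cos_add_pi]
  push_cast
  ext i j
  fin_cases i <;> fin_cases j <;> simp

omit [NormedSpace ℝ E] in
/-- **UNIFORM SUPPORT BOUND**: for `f` with compact support and `z ≠ 0` there is `R > 0` with `f(z·(1 + iu·A(s))) = 0` whenever `R ≤ |u|` (the `(0,1)` and `(1,0)` entries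
`z·iu·cos² s`, `z·iu·sin² s` have norms adding up to `|z|·|u|`). [cite: Varadarajan1989, §6.4 Lemma 21] -/
theorem exists_bound_coneChart (f : Matrix (Fin 2) (Fin 2) ℂ → E) (hfc : HasCompactSupport f) (z : ℂ) (hz : z ≠ 0) :
    ∃ R : ℝ, 0 < R ∧ ∀ s u : ℝ, R ≤ |u| → f (z • ((1 : Matrix (Fin 2) (Fin 2) ℂ) + (((u : ℝ) : ℂ) * Complex.I) •
      !![Complex.I * ((Real.sin s : ℝ) : ℂ) * ((Real.cos s : ℝ) : ℂ), ((Real.cos s : ℝ) : ℂ) ^ 2;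
        ((Real.sin s : ℝ) : ℂ) ^ 2, -(Complex.I * ((Real.sin s : ℝ) : ℂ) * ((Real.cos s : ℝ) : ℂ))])) = 0 := by
  -- the entries `(0,1)`, `(1,0)` are bounded on the support
  obtain ⟨R₁, hR₁⟩ := (hfc.isCompact.image (continuous_id.matrix_elem 0 1)).isBounded.exists_norm_le
  obtain ⟨R₂, hR₂⟩ := (hfc.isCompact.image (continuous_id.matrix_elem 1 0)).isBounded.exists_norm_le
  refine ⟨(|R₁| + |R₂| + 1) / ‖z‖, div_pos (by positivity) (norm_pos_iff.2 hz), fun s u hu => ?_⟩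
  apply image_eq_zero_of_notMem_tsupport
  intro hmem
  have h01 := hR₁ _ ⟨_, hmem, rfl⟩
  have h10 := hR₂ _ ⟨_, hmem, rfl⟩
  simp only [id, Matrix.smul_apply, Matrix.add_apply, Matrix.one_apply, Matrix.of_apply, Matrix.cons_val', Matrix.cons_val_zero,
    Matrix.cons_val_one, Matrix.cons_val_fin_one, Matrix.empty_val', smul_eq_mul] at h01 h10
  have e01 : ‖z * ((0 : ℂ) + ((u : ℝ) : ℂ) * Complex.I * (((Real.cos s : ℝ) : ℂ) ^ 2))‖ = ‖z‖ * |u| * Real.cos s ^ 2 := by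
    rw [zero_add, norm_mul, norm_mul, norm_mul, Complex.norm_I, mul_one, Complex.norm_real, Real.norm_eq_abs, ← Complex.ofReal_pow, Complex.norm_real,
      Real.norm_eq_abs, abs_of_nonneg (sq_nonneg (Real.cos s)), mul_assoc]
  have e10 : ‖z * ((0 : ℂ) + ((u : ℝ) : ℂ) * Complex.I * (((Real.sin s : ℝ) : ℂ) ^ 2))‖ = ‖z‖ * |u| * Real.sin s ^ 2 := by
    rw [zero_add, norm_mul, norm_mul, norm_mul, Complex.norm_I, mul_one, Complex.norm_real, Real.norm_eq_abs, ← Complex.ofReal_pow, Complex.norm_real,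
      Real.norm_eq_abs, abs_of_nonneg (sq_nonneg (Real.sin s)), mul_assoc]
  have hsum : ‖z‖ * |u| * Real.cos s ^ 2 + ‖z‖ * |u| * Real.sin s ^ 2 = ‖z‖ * |u| := by
    rw [← mul_add, Real.cos_sq_add_sin_sq, mul_one]
  have hzu : |R₁| + |R₂| + 1 ≤ ‖z‖ * |u| := by
    have := mul_le_mul_of_nonneg_left hu (norm_nonneg z)
    rwa [mul_div_cancel₀ _ (norm_ne_zero_iff.2 hz)] at this
  have hif1 : (if (0 : Fin 2) = 1 then (1 : ℂ) else 0) = 0 := by simp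
  have hif2 : (if (1 : Fin 2) = 0 then (1 : ℂ) else 0) = 0 := by simp
  rw [hif1] at h01
  rw [hif2] at h10
  rw [e01] at h01
  rw [e10] at h10
  linarith [le_abs_self R₁, le_abs_self R₂]

/-! ## §3 The integral identity: the `K₁ × N` cone functional is twice the (K0±) two-nappe cone value -/

/-- **THE `s`-SECTIONS `I₀(u) = ∫_{s ∈ [0,π]} f(z·(1 + iu·A(s))) ds` ARE A CONTINUOUS COMPACTLY SUPPORTED FUNCTION OF `u`** (parametric interval integral of a
continuous integrand; support from the uniform bound of §2). [cite: Varadarajan1989, §6.4 Lemma 21] -/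
theorem continuous_intervalIntegral_coneChart (f : Matrix (Fin 2) (Fin 2) ℂ → E) (hf : Continuous f) (z : ℂ) (a b : ℝ) :
    Continuous fun u : ℝ => ∫ s in a..b, f (z • ((1 : Matrix (Fin 2) (Fin 2) ℂ) + (((u : ℝ) : ℂ) * Complex.I) •
      !![Complex.I * ((Real.sin s : ℝ) : ℂ) * ((Real.cos s : ℝ) : ℂ), ((Real.cos s : ℝ) : ℂ) ^ 2;
        ((Real.sin s : ℝ) : ℂ) ^ 2, -(Complex.I * ((Real.sin s : ℝ) : ℂ) * ((Real.cos s : ℝ) : ℂ))])) :=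
  intervalIntegral.continuous_parametric_intervalIntegral_of_continuous' (μ := volume) (continuous_coneChart_swap f hf z) a b

/-- **THE CONE INTEGRAL OVER `ℝ∕2πℤ × ℝ` IN ITERATED FORM**: `∫_{ℝ∕2πℤ × ℝ} f(z·(1 + iu·A(s))) d(s,u) = 2 • ∫_u ∫_{s ∈ [0,π]} f(z·(1 + iu·A(s))) ds du` (Fubini for the
continuous compactly supported integrand, the window `(0, 2π]` of `ℝ∕2πℤ`, and `π`-periodicity in `s`). [cite: Varadarajan1989, §6.4] -/
theorem integral_addCircle_prod_coneChart_eq_two_smul [Fact (0 < 2 * π)] (f : Matrix (Fin 2) (Fin 2) ℂ → E) (hf : Continuous f)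
    (hfc : HasCompactSupport f) (z : ℂ) (hz : z ≠ 0) :
    ∫ p : AddCircle (2 * π) × ℝ, f (z • ((1 : Matrix (Fin 2) (Fin 2) ℂ) + (((p.2 : ℝ) : ℂ) * Complex.I) •
        !![Complex.I * ((Real.Angle.sin p.1 : ℝ) : ℂ) * ((Real.Angle.cos p.1 : ℝ) : ℂ), ((Real.Angle.cos p.1 : ℝ) : ℂ) ^ 2;
          ((Real.Angle.sin p.1 : ℝ) : ℂ) ^ 2, -(Complex.I * ((Real.Angle.sin p.1 : ℝ) : ℂ) * ((Real.Angle.cos p.1 : ℝ) : ℂ))])) ∂(volume.prod volume) =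
      (2 : ℝ) • ∫ u : ℝ, ∫ s in (0 : ℝ)..π, f (z • ((1 : Matrix (Fin 2) (Fin 2) ℂ) + (((u : ℝ) : ℂ) * Complex.I) •
        !![Complex.I * ((Real.sin s : ℝ) : ℂ) * ((Real.cos s : ℝ) : ℂ), ((Real.cos s : ℝ) : ℂ) ^ 2;
          ((Real.sin s : ℝ) : ℂ) ^ 2, -(Complex.I * ((Real.sin s : ℝ) : ℂ) * ((Real.cos s : ℝ) : ℂ))])) := by
  -- abbreviations
  obtain ⟨h, hh⟩ : ∃ h : ℝ → ℝ → E, h = fun s u => f (z • ((1 : Matrix (Fin 2) (Fin 2) ℂ) + (((u : ℝ) : ℂ) * Complex.I) •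
      !![Complex.I * ((Real.sin s : ℝ) : ℂ) * ((Real.cos s : ℝ) : ℂ), ((Real.cos s : ℝ) : ℂ) ^ 2;
        ((Real.sin s : ℝ) : ℂ) ^ 2, -(Complex.I * ((Real.sin s : ℝ) : ℂ) * ((Real.cos s : ℝ) : ℂ))])) := ⟨_, rfl⟩
  obtain ⟨H, hH⟩ : ∃ H : AddCircle (2 * π) × ℝ → E, H = fun p => f (z • ((1 : Matrix (Fin 2) (Fin 2) ℂ) + (((p.2 : ℝ) : ℂ) * Complex.I) •
      !![Complex.I * ((Real.Angle.sin p.1 : ℝ) : ℂ) * ((Real.Angle.cos p.1 : ℝ) : ℂ), ((Real.Angle.cos p.1 : ℝ) : ℂ) ^ 2;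
        ((Real.Angle.sin p.1 : ℝ) : ℂ) ^ 2, -(Complex.I * ((Real.Angle.sin p.1 : ℝ) : ℂ) * ((Real.Angle.cos p.1 : ℝ) : ℂ))])) := ⟨_, rfl⟩
  have hHc : Continuous H := by rw [hH]; exact continuous_coneChart_addCircle f hf z
  have hhc : Continuous (Function.uncurry h) := by rw [hh]; exact continuous_coneChart f hf z
  have hcoe : ∀ (a u : ℝ), H ((a : AddCircle (2 * π)), u) = h a u := by
    intro a u
    rw [hH, hh]
    beta_reduce
    rw [Literature.MeasureTheory.Group.cosA_coe, Literature.MeasureTheory.Group.sinA_coe]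
  obtain ⟨R, hR, hzero⟩ := exists_bound_coneChart f hfc z hz
  -- `H` is compactly supported, hence integrable
  have hHsupp : HasCompactSupport H := by
    refine HasCompactSupport.intro (isCompact_univ.prod (isCompact_Icc (a := -R) (b := R))) fun p hp => ?_
    obtain ⟨a, ha⟩ : ∃ a : ℝ, (a : AddCircle (2 * π)) = p.1 := QuotientAddGroup.mk_surjective p.1
    have hp' : R ≤ |p.2| := by
      by_contra hlt
      exact hp (mk_mem_prod (mem_univ _) (abs_le.1 (not_le.1 hlt).le))
    have := hcoe a p.2
    rw [ha] at this
    rw [this, hh]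
    exact hzero a p.2 hp'
  have hHint : Integrable H (volume.prod volume) := hHc.integrable_of_hasCompactSupport hHsupp
  -- Fubini, `u` outside
  have step1 : ∫ p, H p ∂(volume.prod volume) = ∫ u : ℝ, ∫ s : AddCircle (2 * π), H (s, u) := integral_prod_symm H hHint
  -- the `s`-integral over the circle is twice the integral over `[0, π]`
  have hper : ∀ u : ℝ, Function.Periodic (fun s => h s u) π := by
    intro u s
    simp only [hh]
    rw [coneDir_add_pi]
  have step2 : ∀ u : ℝ, ∫ s : AddCircle (2 * π), H (s, u) = (2 : ℝ) • ∫ s in (0 : ℝ)..π, h s u := by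
    intro u
    have hw := AddCircle.integral_preimage (2 * π) 0 (fun s : AddCircle (2 * π) => H (s, u))
    simp only [hcoe, zero_add] at hw
    have hcu : Continuous (fun s : ℝ => h s u) := by exact hhc.comp (continuous_id.prodMk continuous_const)
    rw [← hw, ← intervalIntegral.integral_of_le Real.two_pi_pos.le,
      ← intervalIntegral.integral_add_adjacent_intervals (hcu.intervalIntegrable 0 π) (hcu.intervalIntegrable π (2 * π))]
    have h2 : ∫ s in π..2 * π, h s u = ∫ s in (0 : ℝ)..π, h s u := by
      have := (hper u).intervalIntegral_add_eq π 0
      rw [zero_add] at this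
      rw [show 2 * π = π + π by ring, this]
    rw [h2, two_smul]
  calc ∫ p : AddCircle (2 * π) × ℝ, f (z • ((1 : Matrix (Fin 2) (Fin 2) ℂ) + (((p.2 : ℝ) : ℂ) * Complex.I) •
        !![Complex.I * ((Real.Angle.sin p.1 : ℝ) : ℂ) * ((Real.Angle.cos p.1 : ℝ) : ℂ), ((Real.Angle.cos p.1 : ℝ) : ℂ) ^ 2;
          ((Real.Angle.sin p.1 : ℝ) : ℂ) ^ 2, -(Complex.I * ((Real.Angle.sin p.1 : ℝ) : ℂ) * ((Real.Angle.cos p.1 : ℝ) : ℂ))])) ∂(volume.prod volume)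
      = ∫ p, H p ∂(volume.prod volume) := by rw [hH]
    _ = ∫ u : ℝ, ∫ s : AddCircle (2 * π), H (s, u) := step1
    _ = ∫ u : ℝ, (2 : ℝ) • ∫ s in (0 : ℝ)..π, h s u := integral_congr_ae (Eventually.of_forall step2)
    _ = (2 : ℝ) • ∫ u : ℝ, ∫ s in (0 : ℝ)..π, h s u := integral_smul _ _
    _ = _ := by rw [hh]

/-- **A HALF-CONE INTEGRAL IN ITERATED FORM**: for `h` continuous on `ℝ²` with `h(s, u) = 0` for `|u| ≥ R` and `c ≠ 0`,
`∫_{τ>0, θ∈(0,2π]} h(θ∕2, cτ) d(τ,θ) = ∫_{τ>0} 2 • ∫_{s∈[0,π]} h(s, cτ) ds dτ` (integrable on the strip: it vanishes for `τ > R∕|c|`; Fubini; `s = θ∕2`). [cite: Varadarajan1989, §6.4 Lemma 21] -/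
theorem setIntegral_Ioi_prod_Ioc_coneChart (h : ℝ → ℝ → E) (hhc : Continuous (Function.uncurry h)) (R : ℝ)
    (hzero : ∀ s u : ℝ, R ≤ |u| → h s u = 0) (c : ℝ) (hc : c ≠ 0) :
    ∫ p in Ioi (0 : ℝ) ×ˢ Ioc (0 : ℝ) (2 * π), h (p.2 / 2) (c * p.1) = ∫ τ in Ioi (0 : ℝ), (2 : ℝ) • ∫ s in (0 : ℝ)..π, h s (c * τ) := by
  have hS : MeasurableSet (Ioi (0 : ℝ) ×ˢ Ioc (0 : ℝ) (2 * π)) := measurableSet_Ioi.prod measurableSet_Ioc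
  have hg : Continuous fun p : ℝ × ℝ => h (p.2 / 2) (c * p.1) :=
    hhc.comp ((continuous_snd.div_const 2).prodMk (continuous_const.mul continuous_fst))
  -- integrable on the strip: zero off the compact box `[0, R∕|c|] × [0, 2π]`
  have hint : IntegrableOn (fun p : ℝ × ℝ => h (p.2 / 2) (c * p.1)) (Ioi (0 : ℝ) ×ˢ Ioc (0 : ℝ) (2 * π)) (volume.prod volume) := by
    have hbox : IntegrableOn (fun p : ℝ × ℝ => h (p.2 / 2) (c * p.1)) (Icc (0 : ℝ) (R / |c|) ×ˢ Icc (0 : ℝ) (2 * π)) (volume.prod volume) :=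
      hg.continuousOn.integrableOn_compact (isCompact_Icc.prod isCompact_Icc)
    refine hbox.of_forall_sdiff_eq_zero hS fun p hp => hzero _ _ ?_
    obtain ⟨⟨h1, h2⟩, hnot⟩ := hp
    have hp1 : R / |c| < p.1 := by
      by_contra hle
      exact hnot (mk_mem_prod ⟨le_of_lt h1, not_lt.1 hle⟩ ⟨h2.1.le, h2.2⟩)
    rw [abs_mul]
    have := (div_lt_iff₀ (abs_pos.2 hc)).1 hp1
    rw [abs_of_pos (show (0 : ℝ) < p.1 from h1)]
    linarith
  rw [Measure.volume_eq_prod, setIntegral_prod _ hint]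
  refine setIntegral_congr_fun measurableSet_Ioi fun τ _ => ?_
  rw [← intervalIntegral.integral_of_le Real.two_pi_pos.le,
    intervalIntegral.integral_comp_div (f := fun s => h s (c * τ)) two_ne_zero, zero_div,
    show 2 * π / 2 = π by ring]

/-- **(A0-c), CHART LEVEL: THE `K₁ × N` CONE FUNCTIONAL IS TWICE THE (K0±) TWO-NAPPE CONE VALUE.**  For `f` continuous with compact support on `M₂(ℂ)` and `z ≠ 0`:
`∫_{(s,u) ∈ ℝ∕2πℤ × ℝ} f(z·(1 + iu·A(s))) d(s,u) = 2 · [cone⁺(f,z) + cone⁻(f,z)]`, where `cone^±(f,z) = ∫_{τ>0, θ∈(0,2π]} f(P(z·1 ± τ·diag(zi,−zi) + τ·W^± θ)·½P)` are VERBATIM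
the two half-cone integrals of ★ `exists_tendsto_two_sin_smul_orbitalIntegral_cayley_nhdsGT_nhdsLT` (§1 half-angle identity, Fubini, `u = ±2τ`, `s = θ∕2`, `π`-periodicity).
[cite: Varadarajan1989, §6.4 Lemma 21, Thm 23] [cite: Rogawski1990, §8.2 p. 122] [cite: Shelstad1979, Lemma 4.3 p. 25] -/
theorem integral_addCircle_prod_coneChart_eq_two_smul_cone [Fact (0 < 2 * π)] (f : Matrix (Fin 2) (Fin 2) ℂ → E) (hf : Continuous f)
    (hfc : HasCompactSupport f) (z : ℂ) (hz : z ≠ 0) :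
    ∫ p : AddCircle (2 * π) × ℝ, f (z • ((1 : Matrix (Fin 2) (Fin 2) ℂ) + (((p.2 : ℝ) : ℂ) * Complex.I) •
        !![Complex.I * ((Real.Angle.sin p.1 : ℝ) : ℂ) * ((Real.Angle.cos p.1 : ℝ) : ℂ), ((Real.Angle.cos p.1 : ℝ) : ℂ) ^ 2;
          ((Real.Angle.sin p.1 : ℝ) : ℂ) ^ 2, -(Complex.I * ((Real.Angle.sin p.1 : ℝ) : ℂ) * ((Real.Angle.cos p.1 : ℝ) : ℂ))])) ∂(volume.prod volume) =
      (2 : ℝ) • ((∫ p in Ioi (0 : ℝ) ×ˢ Ioc (0 : ℝ) (2 * π),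
        f ((!![(1 : ℂ), 1; 1, -1] : Matrix (Fin 2) (Fin 2) ℂ) *
          (z • (1 : Matrix (Fin 2) (Fin 2) ℂ) + p.1 • Matrix.diagonal ![z * Complex.I, -(z * Complex.I)] +
            p.1 • !![(0 : ℂ), -(z * Complex.I) * Complex.exp (-((p.2 : ℂ) * Complex.I)); (z * Complex.I) * Complex.exp ((p.2 : ℂ) * Complex.I), 0]) *
          !![(1 / 2 : ℂ), 1 / 2; 1 / 2, -(1 / 2)])) +
       ∫ p in Ioi (0 : ℝ) ×ˢ Ioc (0 : ℝ) (2 * π),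
        f ((!![(1 : ℂ), 1; 1, -1] : Matrix (Fin 2) (Fin 2) ℂ) *
          (z • (1 : Matrix (Fin 2) (Fin 2) ℂ) + p.1 • Matrix.diagonal ![-(z * Complex.I), z * Complex.I] +
            p.1 • !![(0 : ℂ), (z * Complex.I) * Complex.exp (-((p.2 : ℂ) * Complex.I)); -(z * Complex.I) * Complex.exp ((p.2 : ℂ) * Complex.I), 0]) *
          !![(1 / 2 : ℂ), 1 / 2; 1 / 2, -(1 / 2)])) := by
  obtain ⟨h, hh⟩ : ∃ h : ℝ → ℝ → E, h = fun s u => f (z • ((1 : Matrix (Fin 2) (Fin 2) ℂ) + (((u : ℝ) : ℂ) * Complex.I) •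
      !![Complex.I * ((Real.sin s : ℝ) : ℂ) * ((Real.cos s : ℝ) : ℂ), ((Real.cos s : ℝ) : ℂ) ^ 2;
        ((Real.sin s : ℝ) : ℂ) ^ 2, -(Complex.I * ((Real.sin s : ℝ) : ℂ) * ((Real.cos s : ℝ) : ℂ))])) := ⟨_, rfl⟩
  have hhc : Continuous (Function.uncurry h) := by rw [hh]; exact continuous_coneChart f hf z
  obtain ⟨R, hR, hzero⟩ := exists_bound_coneChart f hfc z hz
  have hzero' : ∀ s u : ℝ, R ≤ |u| → h s u = 0 := by rw [hh]; exact hzero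
  -- Step A: the left side is `2 • ∫_u I₀(u)`, `I₀(u) = ∫_{[0,π]} h s u ds`
  rw [integral_addCircle_prod_coneChart_eq_two_smul f hf hfc z hz]
  simp_rw [← show ∀ s u, h s u = f (z • ((1 : Matrix (Fin 2) (Fin 2) ℂ) + (((u : ℝ) : ℂ) * Complex.I) •
      !![Complex.I * ((Real.sin s : ℝ) : ℂ) * ((Real.cos s : ℝ) : ℂ), ((Real.cos s : ℝ) : ℂ) ^ 2;
        ((Real.sin s : ℝ) : ℂ) ^ 2, -(Complex.I * ((Real.sin s : ℝ) : ℂ) * ((Real.cos s : ℝ) : ℂ))])) from fun s u => by rw [hh]]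
  congr 1
  -- `I₀` is continuous with compact support
  set I₀ : ℝ → E := fun u => ∫ s in (0 : ℝ)..π, h s u with hI₀
  have hI₀c : Continuous I₀ := by
    rw [hI₀, hh]; exact continuous_intervalIntegral_coneChart f hf z 0 π
  have hI₀zero : ∀ u : ℝ, R ≤ |u| → I₀ u = 0 := by
    intro u hu
    simp only [hI₀]
    rw [intervalIntegral.integral_congr (g := fun _ => (0 : E)) (fun s _ => hzero' s u hu), intervalIntegral.integral_zero]
  have hI₀supp : HasCompactSupport I₀ := by
    refine HasCompactSupport.intro (isCompact_Icc (a := -R) (b := R)) fun u hu => hI₀zero u ?_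
    by_contra hlt
    exact hu (abs_le.1 (not_le.1 hlt).le)
  -- Step B: the two cone integrals in iterated form
  have hplus : ∫ p in Ioi (0 : ℝ) ×ˢ Ioc (0 : ℝ) (2 * π),
        f ((!![(1 : ℂ), 1; 1, -1] : Matrix (Fin 2) (Fin 2) ℂ) *
          (z • (1 : Matrix (Fin 2) (Fin 2) ℂ) + p.1 • Matrix.diagonal ![z * Complex.I, -(z * Complex.I)] +
            p.1 • !![(0 : ℂ), -(z * Complex.I) * Complex.exp (-((p.2 : ℂ) * Complex.I)); (z * Complex.I) * Complex.exp ((p.2 : ℂ) * Complex.I), 0]) *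
          !![(1 / 2 : ℂ), 1 / 2; 1 / 2, -(1 / 2)]) =
      ∫ τ in Ioi (0 : ℝ), (2 : ℝ) • I₀ (2 * τ) := by
    have hS : MeasurableSet (Ioi (0 : ℝ) ×ˢ Ioc (0 : ℝ) (2 * π)) := measurableSet_Ioi.prod measurableSet_Ioc
    rw [setIntegral_congr_fun hS (fun p _ => show _ = h (p.2 / 2) (2 * p.1) by rw [cayley_conePlus_eq_smul, hh])]
    exact setIntegral_Ioi_prod_Ioc_coneChart h hhc R hzero' 2 two_ne_zero
  have hminus : ∫ p in Ioi (0 : ℝ) ×ˢ Ioc (0 : ℝ) (2 * π),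
        f ((!![(1 : ℂ), 1; 1, -1] : Matrix (Fin 2) (Fin 2) ℂ) *
          (z • (1 : Matrix (Fin 2) (Fin 2) ℂ) + p.1 • Matrix.diagonal ![-(z * Complex.I), z * Complex.I] +
            p.1 • !![(0 : ℂ), (z * Complex.I) * Complex.exp (-((p.2 : ℂ) * Complex.I)); -(z * Complex.I) * Complex.exp ((p.2 : ℂ) * Complex.I), 0]) *
          !![(1 / 2 : ℂ), 1 / 2; 1 / 2, -(1 / 2)]) =
      ∫ τ in Ioi (0 : ℝ), (2 : ℝ) • I₀ (-2 * τ) := by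
    have hS : MeasurableSet (Ioi (0 : ℝ) ×ˢ Ioc (0 : ℝ) (2 * π)) := measurableSet_Ioi.prod measurableSet_Ioc
    rw [setIntegral_congr_fun hS (fun p _ => show _ = h (p.2 / 2) (-2 * p.1) by rw [cayley_coneMinus_eq_smul, hh, neg_mul])]
    exact setIntegral_Ioi_prod_Ioc_coneChart h hhc R hzero' (-2) (by norm_num)
  rw [hplus, hminus]
  -- Step C: reflect the `−` nappe onto `τ < 0` and glue: `∫_{τ>0} φ(τ) + ∫_{τ>0} φ(−τ) = ∫_ℝ φ`
  set φ : ℝ → E := fun τ => (2 : ℝ) • I₀ (2 * τ) with hφ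
  have hφint : Integrable φ := by
    refine Continuous.integrable_of_hasCompactSupport ((hI₀c.comp (continuous_const.mul continuous_id)).const_smul (2 : ℝ)) ?_
    refine HasCompactSupport.intro (isCompact_Icc (a := -R) (b := R)) fun τ hτ => ?_
    simp only [hφ]
    rw [hI₀zero (2 * τ) ?_, smul_zero]
    have hτ' : R < |τ| := by
      by_contra hle
      exact hτ (abs_le.1 (not_lt.1 hle))
    rw [abs_mul, abs_two]
    linarith [abs_nonneg τ]
  have hneg : ∫ τ in Ioi (0 : ℝ), (2 : ℝ) • I₀ (-2 * τ) = ∫ τ in Iic (0 : ℝ), φ τ := by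
    have := integral_comp_neg_Ioi 0 φ
    rw [neg_zero] at this
    rw [← this]
    refine setIntegral_congr_fun measurableSet_Ioi fun τ _ => ?_
    simp only [hφ, mul_neg, neg_mul]
  rw [hneg, show (∫ τ in Ioi (0 : ℝ), (2 : ℝ) • I₀ (2 * τ)) = ∫ τ in Ioi (0 : ℝ), φ τ from rfl, add_comm,
    intervalIntegral.integral_Iic_add_Ioi hφint.integrableOn hφint.integrableOn]
  -- Step D: `∫_ℝ 2 • I₀(2τ) dτ = ∫_ℝ I₀`
  simp only [hφ]
  rw [integral_smul, Measure.integral_comp_mul_left I₀ 2, smul_smul, show (2 : ℝ) * |2⁻¹| = 1 by norm_num, one_smul]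

end Literature.NumberTheory.Automorphic

end
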